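import Literature.InformationTheory.QuantumCodes.CorrectableRegions
import HarnessLib

/-!
# Bravyi–Terhal 2009, Theorem 2: no macroscopic energy barrier for 2D local stabilizer codes — proof

S. Bravyi, B. Terhal, *A no-go theorem for a two-dimensional self-correcting quantum memory based on stabilizer
codes*, New J. Phys. 11 (2009) 043029 = arXiv:0810.1983 [BravyiTerhal2009], §1.2 (chunk p0005 L82–104, p0006
L1–35). The stabilizer Hamiltonian is `H = −Σ_a S_a` for a family of generators `S_1,…,S_m`; «`ε(E) = 2 #{a : S_a E
= −E S_a}`. We shall refer to `ε(E)` as the energy cost of a Pauli operator `E`. Let us say that a sequence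
`P_0, P_1, …, P_t ∈ 𝒫` is a walk on the Pauli group starting at `P_0` and arriving at `P_t` iff for all `i` the
operators `P_i` and `P_{i+1}` differ by at most one qubit. … `ε_max(γ) = max_{P ∈ γ} ε(P)` … the energy barrier …
`d‡ = min_{E ∈ 𝒞(𝒮)∖𝒮} min_{γ ∈ 𝒲(I,E)} ε_max(γ)`.» «Theorem 2. Let `𝒮 = ⟨S_1,…,S_m⟩` be a stabilizer code with
local generators on a 2D lattice such that each qubit participates in a constant number of generators. Then the
energy barrier `d‡` is upper bounded by a constant independent of the lattice size `L`.» Printed proof (§2, p0010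
L36–49): «choose any logical operator `P ∈ 𝒞(𝒮)∖𝒮` with a linear dimension `d_1(P) ≤ r` [Prop. 1]. … if `D = 2`
then the bound `d_1(P) ≤ r` implies that the support of `P` can be covered by a quasi-1D vertical string. One can
construct a walk `γ ∈ 𝒲(I,P)` that implements `P` in a row-by-row fashion. At any intermediate step the contribution
to the energy cost of a partially implemented `P` comes only from the two end-points of the string. The assumption
that any qubit participates in `O(1)` generators `S_a` implies that `ε_max(γ) = O(1)`.»

THIS FILE PROVES Theorem 2 in the tree's symplectic vocabulary (phases dropped: a Pauli operator is its class
`(a|b) ∈ 𝔽₂^{2n}`, `S_a E = −E S_a` iff `⟨S_a, E⟩ = 1`), with OPEN boundary conditions and an explicit constant: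
`BravyiTerhal2009_theorem2` — for a stabilizer code `S̄ = ⟨g_a⟩` with `k ≥ 1` on the `L × L` square lattice
(placement `e`), every generator covered by an `r × r` square and every qubit in the support of at most `g_max`
generators, there is a non-trivial logical operator `E ∈ S̄⊥ ∖ S̄` and a walk `0 = P_0, P_1, …, P_m = E`
(consecutive classes differing on at most one qubit) with `ε(P_i) ≤ 12 r² g_max` for every `i` — so `d‡ ≤ 12 r² g_max`,
independent of `L`.

## Proof (as printed)

* THE STRIP LOGICAL (`exists_logical_in_slab`): Prop. 1's argument as formalised in `LocalCodeDistanceBound.lean`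
  (`sympDual_le_of_slabs`: if no vertical slab of width `w = max(r−1,1)` supports a non-trivial logical operator then
  `S̄⊥ ≤ S̄`), read contrapositively for `k ≥ 1`.
* THE ROW-BY-ROW WALK (`rowWalk`): `P_i = ρ_{U_i} E`, `U_i` = the qubits whose linear index `yL + x` is `< i`
  (`i = 0,…,L²`); consecutive restrictions differ on the at most one qubit of index `i` (`isPauliWalk_rowWalk`).
* THE FRONT (`energyCost_rowWalk_le`): a generator anticommuting with `ρ_{U_i} E` meets `supp E` both inside and
  outside `U_i` (it commutes with `E`), so its `r × r` window straddles the front row `⌊i/L⌋` and meets the strip: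
  its support lies in a fixed `(w + 2r − 2) × (2r − 1)` rectangle of `≤ 6r²` qubits, each in `≤ g_max` generators,
  whence `ε ≤ 2 · 6r² g_max`.

Deliberately NOT here: periodic boundary conditions (the printed «applies to both»; the torus needs the periodic
strip logical of `LocalCodeDistanceBoundPeriodic.lean` and a walk with two fronts — `TODO(general form)`), the
subsystem version Theorem 2* (§3.3; no gauge-group vocabulary in the tree), `D ≥ 3` (where the statement fails:
«we conjecture …» is not Literature), the energy barrier `d‡` as a minimum (we give the walk; no `sInf`).

## References

* [BravyiTerhal2009] arXiv:0810.1983, read via `lit`: §1.2 definitions of `ε(E)`, walks, `ε_max`, `d‡` and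
  Theorem 2 (chunks p0005 L82–104, p0006 L1–35); proof of Theorems 1–2 from Prop. 1 (p0010 L36–49); §3.2
  Eq. (ubound) «`ε(E) ≤ 2 #{a : E G_a = −G_a E}`» (p0013 L44–49).

## Mathlib / tree search

Tree: `colSlab`, `slab`, `slabPair_of_isCubeLocal`, `sympDual_le_of_slabs` (LocalCodeDistanceBound.lean);
`mem_supportedOn_of_forall_sympSupport` (CorrectableRegions.lean); `proj`, `proj_apply_fst/snd`, `supportedOn`, `sympInner_eq_zero_of_supportedOn_compl`
(QuantumSingletonBound.lean); `sympSupport`, `InCube`, `IsCubeLocal` (LocalityBounds.lean); `sympInner_add_left`,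
`sympInner_comm`, `IsAdditiveCode.finrank_sympDual` (SymplecticCodes.lean). No energy-barrier notion existed
(`rg -i "energy barrier|energyCost"` over Literature: prose mentions only).
-/

namespace Literature.InformationTheory.QuantumCodes

open Finset
open Classical

variable {n : ℕ}

/-! ### Energy cost and walks on the Pauli group -/

/-- **Energy cost** of the Pauli class `E` for the stabilizer Hamiltonian `H = −Σ_a S_a` with generator family
`g`: «`ε(E) = 2 #{a : S_a E = −E S_a}`», anticommutation read as `⟨g_a, E⟩ = 1` (the excitation energy of
`E|ψ⟩` above the ground space, `⟨ψ|E†HE|ψ⟩ = −m + ε(E)`). Column: definition.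
[cite: BravyiTerhal2009, §1.2 (p. 5: «ε(E) = 2 #{a : S_a E = −E S_a}. We shall refer to ε(E) as the energy cost»)] -/
noncomputable def energyCost {ι : Type*} [Fintype ι] (g : ι → SympVec n) (E : SympVec n) : ℕ :=
  2 * #(univ.filter fun a => sympInner (g a) E ≠ 0)

/-- **Walk on the Pauli group** (phases dropped): «a sequence `P_0, P_1, …, P_t ∈ 𝒫` is a walk … iff for all `i`
the operators `P_i` and `P_{i+1}` differ by at most one qubit» — consecutive classes have `wt(P_i + P_{i+1}) ≤ 1`.
Column: definition. [cite: BravyiTerhal2009, §1.2 (p. 5, walks 𝒲(S,T))] -/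
def IsPauliWalk {m : ℕ} (γ : Fin (m + 1) → SympVec n) : Prop :=
  ∀ i : Fin m, sympWeight (γ i.castSucc + γ i.succ) ≤ 1

/-- A non-vanishing symplectic product forces the supports to meet. [folklore] -/
private theorem exists_mem_sympSupport_of_sympInner_ne_zero {u v : SympVec n} (h : sympInner u v ≠ 0) :
    ∃ q ∈ sympSupport u, q ∈ sympSupport v := by
  by_contra hne
  push Not at hne
  apply h
  refine sympInner_eq_zero_of_supportedOn_compl (M := sympSupport u)
    (mem_supportedOn_of_forall_sympSupport fun q hq => hq) ?_
  refine mem_supportedOn_of_forall_sympSupport fun q hq => ?_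
  rw [mem_compl]
  exact fun hqu => hne q hqu hq

namespace EnergyBarrier

/-! ### The restriction walk along a labelling -/

section Walk

variable (ℓ : Fin n → ℕ) (E : SympVec n)

/-- The **partially implemented operator**: the restriction of `E` to the qubits of label `< i` («a walk
`γ ∈ 𝒲(I,P)` that implements `P` in a row-by-row fashion»). Column: definition.
[cite: BravyiTerhal2009, §2 proof of Thm. 2 (p. 10, «implements P in a row-by-row fashion»)] -/
noncomputable def prefixWalk (i : ℕ) : SympVec n := proj (univ.filter fun q => ℓ q < i) E

variable {ℓ E}

/-- The walk starts at the identity. [cite: BravyiTerhal2009, §1.2 (walks 𝒲(I,E))] -/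
theorem prefixWalk_zero : prefixWalk ℓ E 0 = 0 := by
  ext q <;> simp [prefixWalk]

/-- The walk arrives at `E` once every label is below the threshold. [cite: BravyiTerhal2009, §1.2 (walks 𝒲(I,E))] -/
theorem prefixWalk_of_forall_lt {m : ℕ} (hm : ∀ q, ℓ q < m) : prefixWalk ℓ E m = E := by
  ext q <;> simp [prefixWalk, hm q]

/-- Consecutive restrictions differ only on the qubits of label exactly `i`; for an injective labelling this is at
most one qubit. [cite: BravyiTerhal2009, §1.2 («differ by at most one qubit»)] -/
theorem sympWeight_prefixWalk_step (hℓ : Function.Injective ℓ) (i : ℕ) :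
    sympWeight (prefixWalk ℓ E i + prefixWalk ℓ E (i + 1)) ≤ 1 := by
  unfold sympWeight
  calc #(univ.filter fun q => (prefixWalk ℓ E i + prefixWalk ℓ E (i + 1)).1 q ≠ 0 ∨
          (prefixWalk ℓ E i + prefixWalk ℓ E (i + 1)).2 q ≠ 0)
      ≤ #(univ.filter fun q : Fin n => ℓ q = i) := by
        refine card_le_card fun q hq => ?_
        simp only [mem_filter, mem_univ, true_and] at hq ⊢
        by_contra hne
        simp only [prefixWalk, Prod.fst_add, Prod.snd_add, Pi.add_apply, proj_apply_fst, proj_apply_snd,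
          mem_filter, mem_univ, true_and] at hq
        have hiff : ℓ q < i ↔ ℓ q < i + 1 := by omega
        by_cases h : ℓ q < i
        · rw [if_pos h, if_pos (hiff.1 h), if_pos h, if_pos (hiff.1 h)] at hq
          simp [CharTwo.add_self_eq_zero] at hq
        · rw [if_neg h, if_neg (fun h' => h (hiff.2 h')), if_neg h, if_neg (fun h' => h (hiff.2 h'))] at hq
          simp at hq
    _ ≤ 1 := by
        rw [Finset.card_le_one]
        intro a ha b hb
        simp only [mem_filter, mem_univ, true_and] at ha hb
        exact hℓ (ha.trans hb.symm)

/-- **Only the front costs energy.** If `⟨g_a, E⟩ = 0` but `⟨g_a, ρ_{U_i} E⟩ ≠ 0`, the generator `g_a` meets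
`supp E` at a qubit of label `< i` AND at a qubit of label `≥ i` («the contribution to the energy cost of a partially
implemented `P` comes only from the … end-points of the string»).
[cite: BravyiTerhal2009, §2 proof of Thm. 2 (p. 10)] -/
theorem exists_crossing_of_sympInner_prefixWalk_ne_zero {u : SympVec n} (hu : sympInner u E = 0) {i : ℕ}
    (h : sympInner u (prefixWalk ℓ E i) ≠ 0) :
    (∃ q ∈ sympSupport u, q ∈ sympSupport E ∧ ℓ q < i) ∧
      (∃ q ∈ sympSupport u, q ∈ sympSupport E ∧ i ≤ ℓ q) := by
  set U : Finset (Fin n) := univ.filter fun q => ℓ q < i with hU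
  have hsplit : sympInner u (proj Uᶜ E) ≠ 0 := by
    intro h0
    apply h
    have hadd : sympInner u (proj U E) + sympInner u (proj Uᶜ E) = sympInner u E := by
      rw [sympInner_comm u (proj U E), sympInner_comm u (proj Uᶜ E), ← sympInner_add_left,
        proj_add_proj_compl, sympInner_comm]
    rw [h0, add_zero, hu] at hadd
    exact hadd
  constructor
  · obtain ⟨q, hqu, hqp⟩ := exists_mem_sympSupport_of_sympInner_ne_zero h
    have hq' : q ∈ sympSupport E ∧ ℓ q < i := by
      simp only [sympSupport, prefixWalk, mem_filter, mem_univ, true_and, proj_apply_fst, proj_apply_snd,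
        ← hU] at hqp ⊢
      by_cases hqU : q ∈ U
      · rw [if_pos hqU, if_pos hqU] at hqp
        exact ⟨hqp, by simpa [hU] using hqU⟩
      · rw [if_neg hqU, if_neg hqU] at hqp
        simp at hqp
    exact ⟨q, hqu, hq'⟩
  · obtain ⟨q, hqu, hqp⟩ := exists_mem_sympSupport_of_sympInner_ne_zero hsplit
    have hq' : q ∈ sympSupport E ∧ i ≤ ℓ q := by
      simp only [sympSupport, mem_filter, mem_univ, true_and, proj_apply_fst, proj_apply_snd] at hqp ⊢
      by_cases hqU : q ∈ Uᶜ
      · rw [if_pos hqU, if_pos hqU] at hqp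
        refine ⟨hqp, ?_⟩
        rw [mem_compl, hU, mem_filter] at hqU
        simp only [mem_univ, true_and, not_lt] at hqU
        exact hqU
      · rw [if_neg hqU, if_neg hqU] at hqp
        simp at hqp
    exact ⟨q, hqu, hq'⟩

end Walk

/-! ### The strip logical operator (Prop. 1) -/

section Strip

variable {L : ℕ} {ι : Type*} {g : ι → SympVec n} {S : Submodule (ZMod 2) (SympVec n)}

/-- **A vertical strip of width `≤ r` supports a non-trivial logical operator** (Prop. 1, `d_1(𝒮) ≤ r`, open
boundary conditions — the contrapositive reading of the tree's `sympDual_le_of_slabs` for `k ≥ 1`): with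
`w = max(r−1,1)`, some slab `{⌊x/w⌋ = j}` supports an element of `S̄⊥ ∖ S̄`.
[cite: BravyiTerhal2009, §2 Prop. 1 («d_1(𝒮) ≤ r») and the proof of Thms. 1–2 («choose any logical operator P ∈ 𝒞(𝒮)∖𝒮 with a linear dimension d_1(P) ≤ r»)] -/
theorem exists_logical_in_slab {D' k d r : ℕ} (e : Fin n ≃ (Fin (D' + 1) → Fin L)) (hr : 1 ≤ r)
    (hS : S = Submodule.span (ZMod 2) (Set.range g)) (hg : ∀ a, IsCubeLocal e r (g a))
    (hcode : IsAdditiveCode S k d) (hk : 1 ≤ k) :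
    ∃ j : ℕ, ∃ Q ∈ sympDual S, Q ∉ S ∧ Q ∈ supportedOn (slab (colSlab e 0 (max (r - 1) 1)) j) := by
  set w : ℕ := max (r - 1) 1 with hwdef
  have hw1 : 1 ≤ w := le_max_right _ _
  have hrw : r ≤ w + 1 := by have := le_max_left (r - 1) 1; omega
  have hsep : ∀ a, ∃ j₀ : ℕ, ∀ q ∈ sympSupport (g a),
      colSlab e 0 w q = j₀ ∨ colSlab e 0 w q = j₀ + 1 :=
    fun a => slabPair_of_isCubeLocal 0 hw1 hrw (hg a)
  by_contra hnone
  push Not at hnone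
  have h0 : ∀ j, ∀ Q ∈ sympDual S, Q ∈ supportedOn (slab (colSlab e 0 w) j) → Q ∈ S := by
    intro j Q hQd hQs
    by_contra hQS
    exact hnone j Q hQd hQS hQs
  have hle := Submodule.finrank_mono (sympDual_le_of_slabs (colSlab e 0 w) g hS hcode.1 hsep h0)
  rw [hcode.finrank_sympDual] at hle
  have hdim := hcode.2.1
  have := hr
  omega

end Strip

/-! ### The row-by-row walk on the `L × L` lattice and the front -/

section Front

variable {L : ℕ} (e : Fin n ≃ (Fin 2 → Fin L))

/-- The **linear (row-major) index** of a qubit of the `L × L` lattice: `yL + x`. Column: definition.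
[cite: BravyiTerhal2009, §2 proof of Thm. 2 («implements P in a row-by-row fashion»)] -/
def rowIndex (q : Fin n) : ℕ := (e q 1 : ℕ) * L + (e q 0 : ℕ)

/-- The **row-by-row walk** implementing `E`: `P_i = ρ_{U_i} E` with `U_i` the qubits of row-major index `< i`,
`i = 0,…,L²`. Column: definition. [cite: BravyiTerhal2009, §2 proof of Thm. 2 («a walk γ ∈ 𝒲(I,P) that implements P in a row-by-row fashion»)] -/
noncomputable def rowWalk (E : SympVec n) : Fin (L * L + 1) → SympVec n :=
  fun i => prefixWalk (rowIndex e) E i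

variable {e}

/-- Quotient and remainder of the row-major index. [folklore] -/
private theorem rowIndex_div_mod (hL : 0 < L) (q : Fin n) :
    rowIndex e q / L = (e q 1 : ℕ) ∧ rowIndex e q % L = (e q 0 : ℕ) := by
  have hx := (e q 0).isLt
  unfold rowIndex
  constructor
  · rw [Nat.add_comm, Nat.add_mul_div_right _ _ hL, Nat.div_eq_of_lt hx, zero_add]
  · rw [Nat.add_comm, Nat.add_mul_mod_self_right, Nat.mod_eq_of_lt hx]

/-- The row-major index is injective. [folklore] -/
private theorem rowIndex_injective (hL : 0 < L) : Function.Injective (rowIndex e) := by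
  intro q q' h
  have h1 := rowIndex_div_mod (e := e) hL q
  have h2 := rowIndex_div_mod (e := e) hL q'
  rw [h] at h1
  apply e.injective
  funext j
  fin_cases j
  · exact Fin.ext (h1.2.symm.trans h2.2)
  · exact Fin.ext (h1.1.symm.trans h2.1)

/-- The row-major index is `< L²`. [folklore] -/
private theorem rowIndex_lt (q : Fin n) : rowIndex e q < L * L := by
  have hx := (e q 0).isLt
  have hy := (e q 1).isLt
  unfold rowIndex
  calc (e q 1 : ℕ) * L + (e q 0 : ℕ) < (e q 1 : ℕ) * L + L := by omega
    _ = ((e q 1 : ℕ) + 1) * L := by ring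
    _ ≤ L * L := Nat.mul_le_mul_right _ (by omega)

/-- The walk starts at the identity. [cite: BravyiTerhal2009, §1.2 (walks 𝒲(I,E))] -/
theorem rowWalk_zero (E : SympVec n) : rowWalk e E 0 = 0 := by
  simp only [rowWalk, Fin.val_zero]
  exact prefixWalk_zero

/-- The walk arrives at `E`. [cite: BravyiTerhal2009, §1.2 (walks 𝒲(I,E))] -/
theorem rowWalk_last (E : SympVec n) : rowWalk e E (Fin.last (L * L)) = E := by
  simp only [rowWalk, Fin.val_last]
  exact prefixWalk_of_forall_lt rowIndex_lt

/-- The row-by-row walk is a walk: consecutive operators differ on at most one qubit.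
[cite: BravyiTerhal2009, §1.2 («differ by at most one qubit»)] -/
theorem isPauliWalk_rowWalk (hL : 0 < L) (E : SympVec n) : IsPauliWalk (rowWalk e E) := by
  intro i
  simp only [rowWalk, Fin.val_castSucc, Fin.val_succ]
  exact sympWeight_prefixWalk_step (rowIndex_injective hL) i

/-- **The front costs `O(1)` energy.** If `E` commutes with every generator, is supported on the vertical strip
`{⌊x/w⌋ = j}` of width `w ≤ r`, every generator is covered by an `r × r` square and every qubit lies in the support
of at most `g_max` generators, then every partially implemented `ρ_{U_i} E` has energy cost `≤ 2r²·g_max`: a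
generator anticommuting with it meets `supp E` at a qubit of the strip at most `r − 1` rows below the front row
`⌊i/L⌋`, and those `≤ r·w` qubits carry `≤ r w g_max` generators.
[cite: BravyiTerhal2009, §2 proof of Thm. 2 (p. 10: «the contribution to the energy cost of a partially implemented P comes only from the two end-points of the string … ε_max(γ) = O(1)»)] -/
theorem energyCost_prefixWalk_le {ι : Type*} [Fintype ι] {g : ι → SympVec n} {r gmax w j : ℕ} (hL : 0 < L)
    (hwr : w ≤ r) (hw : 1 ≤ w) (hg : ∀ a, IsCubeLocal e r (g a))
    (hdeg : ∀ q : Fin n, #(univ.filter fun a => q ∈ sympSupport (g a)) ≤ gmax) {E : SympVec n}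
    (hE : ∀ a, sympInner (g a) E = 0) (hEs : E ∈ supportedOn (slab (colSlab e 0 w) j)) (i : ℕ) :
    energyCost g (prefixWalk (rowIndex e) E i) ≤ 2 * r ^ 2 * gmax := by
  unfold energyCost
  set y₀ := i / L with hy₀
  -- the qubits of the strip at most r − 1 rows below the front
  set R : Finset (Fin n) := univ.filter fun q =>
    j * w ≤ (e q 0 : ℕ) ∧ (e q 0 : ℕ) < j * w + w ∧ (e q 1 : ℕ) ≤ y₀ ∧ y₀ < (e q 1 : ℕ) + r with hR
  have hRcard : #R ≤ r * w := by
    calc #R ≤ #((Finset.Ico (j * w) (j * w + w)) ×ˢ (Finset.Ico (y₀ + 1 - r) (y₀ + 1))) := by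
          refine card_le_card_of_injOn (fun q => ((e q 0 : ℕ), (e q 1 : ℕ))) ?_ ?_
          · intro q hq
            have hq' := (mem_filter.1 (mem_coe.1 hq)).2
            simp only [coe_product, Set.mem_prod, mem_coe, Finset.mem_Ico]
            omega
          · intro q _ q' _ h
            simp only [Prod.mk.injEq] at h
            apply e.injective
            funext j'
            fin_cases j'
            · exact Fin.ext h.1
            · exact Fin.ext h.2
      _ ≤ r * w := by
          rw [card_product, Nat.card_Ico, Nat.card_Ico, mul_comm]
          exact Nat.mul_le_mul (by omega) (by omega)
  -- every anticommuting generator meets R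
  have hsub : (univ.filter fun a => sympInner (g a) (prefixWalk (rowIndex e) E i) ≠ 0) ⊆
      R.biUnion (fun q => univ.filter fun a => q ∈ sympSupport (g a)) := by
    intro a ha
    simp only [mem_filter, mem_univ, true_and] at ha
    obtain ⟨⟨q₁, hq₁a, hq₁E, hq₁i⟩, ⟨q₂, hq₂a, -, hq₂i⟩⟩ :=
      exists_crossing_of_sympInner_prefixWalk_ne_zero (hE a) ha
    rw [mem_biUnion]
    refine ⟨q₁, ?_, by simpa using hq₁a⟩
    obtain ⟨c, hc⟩ := hg a
    have h1x := (hc q₁ hq₁a 0)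
    have h1y := (hc q₁ hq₁a 1)
    have h2y := (hc q₂ hq₂a 1)
    -- q₁ lies in the strip: ⌊x₁/w⌋ = j
    have hslab : (e q₁ 0 : ℕ) / w = j := by
      by_contra hne
      have hq₁0 := hEs q₁ (by simpa [colSlab] using hne)
      simp only [sympSupport, mem_filter, mem_univ, true_and] at hq₁E
      rcases hq₁E with h | h
      · exact h hq₁0.1
      · exact h hq₁0.2
    have hjw : j * w ≤ (e q₁ 0 : ℕ) ∧ (e q₁ 0 : ℕ) < j * w + w := by
      constructor
      · have := Nat.div_mul_le_self (e q₁ 0 : ℕ) w; rw [hslab] at this; exact this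
      · have := Nat.lt_div_mul_add (a := (e q₁ 0 : ℕ)) hw; rw [hslab] at this; exact this
    -- rows: index q₁ < i ≤ index q₂ gives y₁ ≤ y₀ ≤ y₂, and the window has height r
    have hd1 := rowIndex_div_mod (e := e) hL q₁
    have hd2 := rowIndex_div_mod (e := e) hL q₂
    have hy₁ : (e q₁ 1 : ℕ) ≤ y₀ := by
      rw [← hd1.1, hy₀]
      exact Nat.div_le_div_right hq₁i.le
    have hy₂ : y₀ ≤ (e q₂ 1 : ℕ) := by
      rw [← hd2.1, hy₀]
      exact Nat.div_le_div_right hq₂i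
    rw [hR, mem_filter]
    exact ⟨mem_univ _, hjw.1, hjw.2, hy₁, by omega⟩
  calc 2 * #(univ.filter fun a => sympInner (g a) (prefixWalk (rowIndex e) E i) ≠ 0)
      ≤ 2 * #(R.biUnion fun q => univ.filter fun a => q ∈ sympSupport (g a)) :=
        Nat.mul_le_mul_left _ (card_le_card hsub)
    _ ≤ 2 * ∑ q ∈ R, #(univ.filter fun a => q ∈ sympSupport (g a)) :=
        Nat.mul_le_mul_left _ card_biUnion_le
    _ ≤ 2 * ∑ _q ∈ R, gmax := Nat.mul_le_mul_left _ (sum_le_sum fun q _ => hdeg q)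
    _ = 2 * (#R * gmax) := by rw [sum_const, smul_eq_mul]
    _ ≤ 2 * (r * w * gmax) := by gcongr
    _ ≤ 2 * (r * r * gmax) := by gcongr
    _ = 2 * r ^ 2 * gmax := by ring

end Front

end EnergyBarrier

/-! ### Theorem 2 -/

open EnergyBarrier in
/-- **Bravyi–Terhal 2009, Theorem 2 — proved (open boundary conditions, explicit constant).** «Let
`𝒮 = ⟨S_1,…,S_m⟩` be a stabilizer code with local generators on a 2D lattice such that each qubit participates in a
constant number of generators. Then the energy barrier `d‡` is upper bounded by a constant independent of the
lattice size `L`.» Typed: for a self-orthogonal `S̄ = ⟨g_a⟩_{a ∈ ι}` with `k ≥ 1` logical qubits on the `L × L`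
square lattice (placement `e`), every generator covered by an `r × r` square (`r ≥ 1`) and every qubit in the support
of at most `g_max` generators, there is a non-trivial logical operator `E ∈ S̄⊥ ∖ S̄` and a walk
`0 = P_0, …, P_{L²} = E` on the Pauli group (consecutive classes differ on at most one qubit) along which the energy
cost `ε(P_i) = 2 #{a : ⟨g_a, P_i⟩ = 1}` never exceeds `2 r² g_max`; hence `d‡ ≤ 2 r² g_max` for every `L`
(2D stabilizer Hamiltonians are not self-correcting memories). Column: proved theorem.
-- TODO(general form): periodic boundary conditions («applies to both open and periodic boundary conditions»);
-- the subsystem version Theorem 2* (gauge qubits).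
[cite: BravyiTerhal2009, §1.2 Thm. 2 (p. 6) with the proof on p. 10 (Prop. 1 + row-by-row walk)] -/
theorem BravyiTerhal2009_theorem2 {L n k d : ℕ} (r gmax : ℕ) (e : Fin n ≃ (Fin 2 → Fin L)) {ι : Type*}
    [Fintype ι] (g : ι → SympVec n) {S : Submodule (ZMod 2) (SympVec n)} (hr : 1 ≤ r)
    (hS : S = Submodule.span (ZMod 2) (Set.range g)) (hg : ∀ a, IsCubeLocal e r (g a))
    (hdeg : ∀ q : Fin n, #(univ.filter fun a => q ∈ sympSupport (g a)) ≤ gmax) (hcode : IsAdditiveCode S k d)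
    (hk : 1 ≤ k) :
    ∃ E ∈ sympDual S, E ∉ S ∧ ∃ (m : ℕ) (γ : Fin (m + 1) → SympVec n),
      γ 0 = 0 ∧ γ (Fin.last m) = E ∧ IsPauliWalk γ ∧ ∀ i, energyCost g (γ i) ≤ 2 * r ^ 2 * gmax := by
  have hn : n = L ^ 2 := by simpa using Fintype.card_congr e
  have hL : 0 < L := by
    rcases Nat.eq_zero_or_pos L with h | h
    · exfalso
      rw [h] at hn
      have := hcode.2.1
      simp at hn
      omega
    · exact h
  obtain ⟨j, Q, hQd, hQS, hQs⟩ := exists_logical_in_slab (D' := 1) e hr hS hg hcode hk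
  have hE : ∀ a, sympInner (g a) Q = 0 := fun a =>
    (mem_sympDual_iff.1 hQd) (g a) (by rw [hS]; exact Submodule.subset_span ⟨a, rfl⟩)
  refine ⟨Q, hQd, hQS, L * L, rowWalk e Q, rowWalk_zero Q, rowWalk_last Q, isPauliWalk_rowWalk hL Q, fun i => ?_⟩
  have hw1 : 1 ≤ max (r - 1) 1 := le_max_right _ _
  have hwr : max (r - 1) 1 ≤ r := max_le (Nat.sub_le r 1) hr
  exact energyCost_prefixWalk_le hL hwr hw1 hg hdeg hE hQs i

end Literature.InformationTheory.QuantumCodes
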